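import Summits.QuantumAdvantage.QuantumAdvantage.Theorems.CubicForrelationNearExactIsExactCubicFormR4LevelCells
import Summits.QuantumAdvantage.QuantumAdvantage.Theorems.CubicForrelationNearExactIsExactCubicFormR4CellForms
import Summits.QuantumAdvantage.QuantumAdvantage.Theorems.CubicForrelationNearExactIsExactCubicFormR4QfCells
import Summits.QuantumAdvantage.QuantumAdvantage.Theorems.CubicForrelationNearExactIsExactCubicFormR4TCells
import Summits.QuantumAdvantage.QuantumAdvantage.Theorems.CubicForrelationNearExactIsExactCubicFormR4TBudget
import Summits.QuantumAdvantage.QuantumAdvantage.Theorems.CubicForrelationNearExactIsExactCubicFormR4TForty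
import Summits.QuantumAdvantage.QuantumAdvantage.Theorems.CubicForrelationNearExactIsExactCubicFormR4TRadical

/-!
# Crux `CubicForrelation.NearExactIsExact` (stmt-QuantumAdvantage-14043) — E1280-even, R4 branch: the descendant `T` (`HL 1`) is
  contradictory

Certificate seat `b2b-cforr-cert` (gen 43).  HONEST FRAMING: kernel-checked theorem (standard axioms) discharging the SECOND of the three
named endgames (`HZ`, `HL 1`, `HL 2`) of …CubicFormR4PartnerDispatch / …CubicFormR4PartnerAssembly (`HL 2` is …CubicFormR4LevelTwo); `HZ`
remains, so `HR4` and `θ₁₂ = 57/64` are NOT yet kernel theorems; `θ₁₂ ∈ [57/64, 29/32)` is formally unchanged; NOT summit progress.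

`tpw_R4_level_one` is LITERALLY the hypothesis `HL1` of `tpw_R4_HL_of_levels`: in the adapted R4 frame (`y_a = e₀`, `v = e₁..e₄`,
`z = e₅..e₁₁`, frame identity, `hF`) with a partnered cubic form, weight `< 1280` and a lightest `Z₁₀`-cell of weight `16` whose third
differences are those of `s₀s₁s₂`, we derive `False` (R4-PARTNER §5 / HANDPROOFS §2.2–2.3, reorganised; no menus, no coordinate changes):
1. `tpw_R4_level_cells`: all sixteen cells `f_v` share the cubic form `s₀s₁s₂`, weigh `16` (exact) or `≥ 32`, and `Σ_{Z₁₀} #f_v ≤ 255`;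
   exact cells are periodic along the free coordinates `z₃..z₆` (`tq4_cell_period`).
2. For free `σ` and any `k` the second difference `a_{σk}(v) = Δ_{z_σ,z_k} f_v(0)` is affine in `v` (`tc5_second_rho`) and vanishes on
   the exact cells; the budget lemmas of …CubicFormR4TBudget govern such affine functions.
3. If some `a_{σk}` with `σ, k` both free is nonzero, every cell where it is `1` weighs `≥ 40` (…CubicFormR4TForty) — budget `G40`.
4. Otherwise, if some `a_{σk}` (`k ≤ 2`) is nonzero (`=: α`), all `a_{σk}` are multiples `Ξ_{σk}·α` (`G5`); a nonzero `u` in the free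
   block with `uᵀΞ = 0` (`tq1_dep4`) has `Δ_{u,e_k} f_v(0) = 0` for all cells, so `D_u f_v` is constant (…CubicFormR4TCells), not flipping
   on `Z₁₀` (`G64`), and …CubicFormR4TRadical (`tq1_radical_step`) produces a radical vector of `d` — contradiction.
5. Otherwise all `a_{σk}` vanish: every `D_{z_σ} f_v` is constant; at most one cell of `Z₁₀` flips (two `64`s break the budget), and
   `u ∈ {e₃, e₄, e₃ ⊕ e₄}` dodging it feeds `tq1_radical_step` again.
Nothing else about `θ₁₂`.

References: this seat lineage (g37 R4-PARTNER §5, g39 HANDPROOFS §2.2–2.3, g42/g43 notes).  Axioms: the standard three.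
-/

set_option linter.dupNamespace false -- D-0017: single-problem summit ⇒ `QuantumAdvantage.QuantumAdvantage` by design

namespace Summit.QuantumAdvantage.QuantumAdvantage.Theorems.CubicForrelation.NearExactIsExact

open Finset
open Literature.Computability.QuantumComplexity
open Literature.Computability.QuantumComplexity.BuzetChailloux (bxor zeroVec bxor_comm bxor_self bxor_zeroVec zeroVec_bxor
  bxor_bxor_cancel_left)

/-- Bool bookkeeping: an affine form with coefficients scaled by a bit. [folklore] -/
theorem tq1_af_smul (x e e0 e1 e2 e3 : Bool) (v : Fin 4 → Bool) :
    (((((x && e) ^^ (v 0 && (x && e0))) ^^ (v 1 && (x && e1))) ^^ (v 2 && (x && e2))) ^^ (v 3 && (x && e3))) =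
      (x && (((( e ^^ (v 0 && e0)) ^^ (v 1 && e1)) ^^ (v 2 && e2)) ^^ (v 3 && e3))) := by
  cases x <;> simp

/-- Bool bookkeeping: a common factor of four scaled terms. [folklore] -/
theorem tq1_xor4_factor : ∀ (u0 u1 u2 u3 a b c d z : Bool),
    ((((u0 && (a && z)) ^^ (u1 && (b && z))) ^^ (u2 && (c && z))) ^^ (u3 && (d && z))) =
      ((((u0 && a) ^^ (u1 && b)) ^^ ((u2 && c) ^^ (u3 && d))) && z) := by
  decide

/-- **Descendant `T` is contradictory** — literally hypothesis `HL1` of `tpw_R4_HL_of_levels` (…CubicFormR4PartnerAssembly).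
See the module docstring for the proof. [this work] -/
theorem tpw_R4_level_one : ∀ (hk : 1 + 1 + 1 ≤ 7), 1 ≤ 1 → 1 ≤ 2 →
    ∀ (κ : (Fin (5 + 7) → Bool) → Bool), IsDegLeFun 3 κ →
    ∀ (c d : Fin (5 + 7) → Fin (5 + 7) → Fin (5 + 7) → ZMod 2),
    (∀ p j k, c p k j = c p j k) → (∀ p j k, c j p k = c p j k) → (∀ p j, c p j j = 0) →
    (∀ φ j k, d φ k j = d φ j k) → (∀ φ j k, d j φ k = d φ j k) → (∀ φ j, d φ j j = 0) →
    (∀ φ j k, d φ j k =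
      if ((((κ zeroVec ^^ κ (bxor zeroVec (fun l => decide (l = k)))) ^^
              (κ (bxor zeroVec (fun l => decide (l = j))) ^^ κ (bxor (bxor zeroVec (fun l => decide (l = j))) (fun l => decide (l = k))))) ^^
            ((κ (bxor zeroVec (fun l => decide (l = φ))) ^^ κ (bxor (bxor zeroVec (fun l => decide (l = φ))) (fun l => decide (l = k)))) ^^
              (κ (bxor (bxor zeroVec (fun l => decide (l = φ))) (fun l => decide (l = j))) ^^
                κ (bxor (bxor (bxor zeroVec (fun l => decide (l = φ))) (fun l => decide (l = j))) (fun l => decide (l = k))))))) = true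
      then 1 else 0) →
    (∀ p φ, (∑ j, ∑ k, (if j < k then c p j k * d φ j k else 0)) = if p = φ then 1 else 0) →
    (∀ y, (κ y ^^ κ (bxor y (fun l => decide (l = Fin.castAdd 7 (0 : Fin 5))))) =
      ((y (Fin.castAdd 7 (1 : Fin 5)) && y (Fin.castAdd 7 (2 : Fin 5))) ^^ (y (Fin.castAdd 7 (3 : Fin 5)) && y (Fin.castAdd 7 (4 : Fin 5))))) →
    (∀ j k, d (Fin.castAdd 7 (0 : Fin 5)) j k =
      (if (j = Fin.castAdd 7 (1 : Fin 5) ∧ k = Fin.castAdd 7 (2 : Fin 5)) ∨ (j = Fin.castAdd 7 (2 : Fin 5) ∧ k = Fin.castAdd 7 (1 : Fin 5)) then 1 else 0) +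
      (if (j = Fin.castAdd 7 (3 : Fin 5) ∧ k = Fin.castAdd 7 (4 : Fin 5)) ∨ (j = Fin.castAdd 7 (4 : Fin 5) ∧ k = Fin.castAdd 7 (3 : Fin 5)) then 1 else 0)) →
    #(univ.filter fun y : Fin (5 + 7) → Bool => κ y = true) < 1280 →
    ∀ (vc : Fin 4 → Bool), ((vc 0 && vc 1) ^^ (vc 2 && vc 3)) = false →
    (∀ v' : Fin 4 → Bool, ((v' 0 && v' 1) ^^ (v' 2 && v' 3)) = false →
      #(univ.filter fun s : Fin 7 → Bool => κ (Fin.append (Matrix.vecCons false vc) s) = true) ≤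
        #(univ.filter fun s : Fin 7 → Bool => κ (Fin.append (Matrix.vecCons false v') s) = true)) →
    4 * #(univ.filter fun s : Fin 7 → Bool => κ (Fin.append (Matrix.vecCons false vc) s) = true) + 2 ^ (7 - 1) = 2 ^ 7 →
    ∀ (bz : Bool), (∀ s : Fin 7 → Bool, κ (Fin.append (Matrix.vecCons false vc) s) = true → s (Fin.castLE hk (Fin.castAdd 1 (Fin.castAdd 1 (0 : Fin 1)))) = bz) →
    (∀ u v w x : Fin 7 → Bool,
      ((((κ (Fin.append (Matrix.vecCons false vc) x) ^^ κ (Fin.append (Matrix.vecCons false vc) (bxor x w))) ^^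
              (κ (Fin.append (Matrix.vecCons false vc) (bxor x v)) ^^ κ (Fin.append (Matrix.vecCons false vc) (bxor (bxor x v) w)))) ^^
            ((κ (Fin.append (Matrix.vecCons false vc) (bxor x u)) ^^ κ (Fin.append (Matrix.vecCons false vc) (bxor (bxor x u) w))) ^^
              (κ (Fin.append (Matrix.vecCons false vc) (bxor (bxor x u) v)) ^^
                κ (Fin.append (Matrix.vecCons false vc) (bxor (bxor (bxor x u) v) w)))))) =
      ((((u (Fin.castLE hk (Fin.castAdd 1 (Fin.castAdd 1 (0 : Fin 1)))) &&
            decide ((∑ ii : Fin 1, ((if v (Fin.castLE hk (Fin.castAdd 1 (Fin.natAdd 1 ii))) = true then (1 : ZMod 2) else 0) * (if w (Fin.castLE hk (Fin.natAdd (1 + 1) ii)) = true then (1 : ZMod 2) else 0) +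
              (if v (Fin.castLE hk (Fin.natAdd (1 + 1) ii)) = true then (1 : ZMod 2) else 0) * (if w (Fin.castLE hk (Fin.castAdd 1 (Fin.natAdd 1 ii))) = true then (1 : ZMod 2) else 0))) = 1)) ^^
          (v (Fin.castLE hk (Fin.castAdd 1 (Fin.castAdd 1 (0 : Fin 1)))) &&
            decide ((∑ ii : Fin 1, ((if u (Fin.castLE hk (Fin.castAdd 1 (Fin.natAdd 1 ii))) = true then (1 : ZMod 2) else 0) * (if w (Fin.castLE hk (Fin.natAdd (1 + 1) ii)) = true then (1 : ZMod 2) else 0) +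
              (if u (Fin.castLE hk (Fin.natAdd (1 + 1) ii)) = true then (1 : ZMod 2) else 0) * (if w (Fin.castLE hk (Fin.castAdd 1 (Fin.natAdd 1 ii))) = true then (1 : ZMod 2) else 0))) = 1))) ^^
          (w (Fin.castLE hk (Fin.castAdd 1 (Fin.castAdd 1 (0 : Fin 1)))) &&
            decide ((∑ ii : Fin 1, ((if u (Fin.castLE hk (Fin.castAdd 1 (Fin.natAdd 1 ii))) = true then (1 : ZMod 2) else 0) * (if v (Fin.castLE hk (Fin.natAdd (1 + 1) ii)) = true then (1 : ZMod 2) else 0) +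
              (if u (Fin.castLE hk (Fin.natAdd (1 + 1) ii)) = true then (1 : ZMod 2) else 0) * (if v (Fin.castLE hk (Fin.castAdd 1 (Fin.natAdd 1 ii))) = true then (1 : ZMod 2) else 0))) = 1))))) → False := by
  intro hk h11 h12 κ hκ c d hcs hcc hcd hds hdc hdd hd hpair hD hF hlt vc hvc hmin hex bz hbz hT
  -- Step 0: the cells in normal coordinates (`lo = 0`, `hi = 1` as maps `Fin 1 → Fin 6`; free coordinates `3..6` of `Fin 7`)
  obtain ⟨lo, hi, hlo, hhi, hlohi, hlov, hhiv, hshare, -, -, -, hbudget, hcells⟩ :=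
    tpw_R4_level_cells κ hκ d hd hD hlt 1 hk h11 h12 vc hT
  have hlo0 : (lo 0).val = 0 := hlov 0
  have hhi0 : (hi 0).val = 1 := hhiv 0
  have hlohi0 : lo 0 ≠ hi 0 := hlohi 0 0
  have h16 : ∀ v : Fin 4 → Bool, 16 ≤ #(univ.filter fun s : Fin 7 → Bool => κ (Fin.append (Matrix.vecCons false v) s) = true) := by
    intro v
    have e1 := (hcells v).1
    have h16' : (2 : ℕ) ^ (5 - 1) = 16 := by norm_num
    rw [h16'] at e1
    omega
  have hvc16 : #(univ.filter fun s : Fin 7 → Bool => κ (Fin.append (Matrix.vecCons false vc) s) = true) < 32 := by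
    have h64 : (2 : ℕ) ^ (7 - 1) = 64 := by norm_num
    have h128 : (2 : ℕ) ^ 7 = 128 := by norm_num
    rw [h64, h128] at hex
    omega
  -- free coordinates as suffix coordinates
  have hfreeσ : ∀ σ : Fin 7, 3 ≤ σ.val → ∃ m : Fin 6, (Fin.natAdd 1 m : Fin (1 + 6)) = σ ∧ (∀ i, lo i ≠ m) ∧ (∀ i, hi i ≠ m) ∧
      m ≠ lo 0 ∧ m ≠ hi 0 := by
    intro σ hσ
    refine ⟨⟨σ.val - 1, by omega⟩, Fin.ext (by simp; omega), fun i h => ?_, fun i h => ?_, fun h => ?_, fun h => ?_⟩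
    · have e1 := hlov i; rw [h] at e1; have := i.isLt; simp at e1; omega
    · have e1 := hhiv i; rw [h] at e1; have := i.isLt; simp at e1; omega
    · have e1 := congrArg Fin.val h; rw [hlo0] at e1; simp at e1; omega
    · have e1 := congrArg Fin.val h; rw [hhi0] at e1; simp at e1; omega
  -- Step 1: exact cells are periodic along every free coordinate
  have hper : ∀ σ : Fin 7, 3 ≤ σ.val → ∀ v : Fin 4 → Bool, #(univ.filter fun s : Fin 7 → Bool => κ (Fin.append (Matrix.vecCons false v) s) = true) < 32 → ∀ s : Fin 7 → Bool,
      κ (Fin.append (Matrix.vecCons false v) (bxor s (fun l => decide (l = σ)))) = κ (Fin.append (Matrix.vecCons false v) s) := by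
    intro σ hσ v hv s
    obtain ⟨m, hσm, hlm, hhm, -, -⟩ := hfreeσ σ hσ
    have P := tq4_cell_period (fun s : Fin (1 + 6) → Bool => κ (Fin.append (Matrix.vecCons false v) s)) 1 (by norm_num) (by norm_num)
      lo hi hlo hhi hlohi
      (fun a b : Fin 6 → Bool => decide ((∑ ii : Fin 1, ((if a (lo ii) = true then (1 : ZMod 2) else 0) * (if b (hi ii) = true then (1 : ZMod 2) else 0) + (if a (hi ii) = true then (1 : ZMod 2) else 0) * (if b (lo ii) = true then (1 : ZMod 2) else 0))) = 1)) (fun a b => rfl) (hshare (Matrix.vecCons false v)) hv m hlm hhm s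
    rw [hσm] at P
    exact P
  -- Step 2: `d` vanishes on `z_σ × z × z` for free `σ` (the normal form `s₀s₁s₂`)
  have hzz : ∀ σ : Fin 7, 3 ≤ σ.val → ∀ j k : Fin 7, d (Fin.natAdd 5 σ) (Fin.natAdd 5 j) (Fin.natAdd 5 k) = 0 := by
    intro σ hσ j k
    have h3 := tc5_third_rho_unit κ hκ (Matrix.vecCons false vc) σ j k zeroVec zeroVec
    dsimp only at h3
    rw [hd, ← h3]
    have e1 := hshare (Matrix.vecCons false vc) (fun l => decide (l = σ)) (fun l => decide (l = j)) (fun l => decide (l = k)) zeroVec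
    have hc0 : decide ((Fin.castAdd 6 (0 : Fin 1) : Fin (1 + 6)) = σ) = false :=
      decide_eq_false (fun h => by have := congrArg Fin.val h; simp at this; omega)
    have hlo' : ∀ ii : Fin 1, decide ((Fin.natAdd 1 (lo ii) : Fin (1 + 6)) = σ) = false := fun ii =>
      decide_eq_false (fun h => by have hv := congrArg Fin.val h; have e2 := hlov ii; have h1 := ii.isLt; simp only [Fin.val_natAdd] at hv; omega)
    have hhi' : ∀ ii : Fin 1, decide ((Fin.natAdd 1 (hi ii) : Fin (1 + 6)) = σ) = false := fun ii =>
      decide_eq_false (fun h => by have hv := congrArg Fin.val h; have e2 := hhiv ii; have h1 := ii.isLt; simp only [Fin.val_natAdd] at hv; omega)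
    have h01 : decide ((0 : ZMod 2) = 1) = false := by decide
    simp only [hc0, hlo', hhi', Bool.false_eq_true, if_false, zero_mul, add_zero, sum_const_zero, h01,
      Bool.false_and, Bool.and_false, Bool.xor_false] at e1
    rw [e1]
    simp
  -- Step 3: the second differences `a_σk(v) = Δ_(e_σ,e_k) f_v(0)` are affine in `v` …
  have haffine : ∀ (σ k : Fin 7) (v : Fin 4 → Bool), ((κ (Fin.append (Matrix.vecCons false v) zeroVec) ^^ κ (Fin.append (Matrix.vecCons false v) (fun l => decide (l = k)))) ^^ (κ (Fin.append (Matrix.vecCons false v) (fun l => decide (l = σ))) ^^ κ (Fin.append (Matrix.vecCons false v) (bxor (fun l => decide (l = σ)) (fun l => decide (l = k)))))) =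
      ((((((κ zeroVec ^^ κ (bxor zeroVec (fun l => decide (l = Fin.natAdd 5 k)))) ^^ (κ (bxor zeroVec (fun l => decide (l = Fin.natAdd 5 σ))) ^^ κ (bxor (bxor zeroVec (fun l => decide (l = Fin.natAdd 5 σ))) (fun l => decide (l = Fin.natAdd 5 k))))) ^^ (v 0 && (((κ zeroVec ^^ κ (bxor zeroVec (fun l => decide (l = Fin.natAdd 5 k)))) ^^ (κ (bxor zeroVec (fun l => decide (l = Fin.natAdd 5 σ))) ^^ κ (bxor (bxor zeroVec (fun l => decide (l = Fin.natAdd 5 σ))) (fun l => decide (l = Fin.natAdd 5 k))))) ^^ ((κ (bxor zeroVec (fun l => decide (l = Fin.castAdd 7 (1 : Fin 5)))) ^^ κ (bxor (bxor zeroVec (fun l => decide (l = Fin.castAdd 7 (1 : Fin 5)))) (fun l => decide (l = Fin.natAdd 5 k)))) ^^ (κ (bxor (bxor zeroVec (fun l => decide (l = Fin.castAdd 7 (1 : Fin 5)))) (fun l => decide (l = Fin.natAdd 5 σ))) ^^ κ (bxor (bxor (bxor zeroVec (fun l => decide (l = Fin.castAdd 7 (1 : Fin 5)))) (fun l => decide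 (l = Fin.natAdd 5 σ))) (fun l => decide (l = Fin.natAdd 5 k)))))))) ^^ (v 1 && (((κ zeroVec ^^ κ (bxor zeroVec (fun l => decide (l = Fin.natAdd 5 k)))) ^^ (κ (bxor zeroVec (fun l => decide (l = Fin.natAdd 5 σ))) ^^ κ (bxor (bxor zeroVec (fun l => decide (l = Fin.natAdd 5 σ))) (fun l => decide (l = Fin.natAdd 5 k))))) ^^ ((κ (bxor zeroVec (fun l => decide (l = Fin.castAdd 7 (2 : Fin 5)))) ^^ κ (bxor (bxor zeroVec (fun l => decide (l = Fin.castAdd 7 (2 : Fin 5)))) (fun l => decide (l = Fin.natAdd 5 k)))) ^^ (κ (bxor (bxor zeroVec (fun l => decide (l = Fin.castAdd 7 (2 : Fin 5)))) (fun l => decide (l = Fin.natAdd 5 σ))) ^^ κ (bxor (bxor (bxor zeroVec (fun l => decide (l = Fin.castAdd 7 (2 : Fin 5)))) (fun l => decide (l = Fin.natAdd 5 σ))) (fun l => decide (l = Fin.natAdd 5 k)))))))) ^^ (v 2 && (((κ zeroVec ^^ κ (bxor zeroVec (fun l => decide (l = Fin.natAdd 5 k)))) ^^ (κ (bxor zeroVec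 (fun l => decide (l = Fin.natAdd 5 σ))) ^^ κ (bxor (bxor zeroVec (fun l => decide (l = Fin.natAdd 5 σ))) (fun l => decide (l = Fin.natAdd 5 k))))) ^^ ((κ (bxor zeroVec (fun l => decide (l = Fin.castAdd 7 (3 : Fin 5)))) ^^ κ (bxor (bxor zeroVec (fun l => decide (l = Fin.castAdd 7 (3 : Fin 5)))) (fun l => decide (l = Fin.natAdd 5 k)))) ^^ (κ (bxor (bxor zeroVec (fun l => decide (l = Fin.castAdd 7 (3 : Fin 5)))) (fun l => decide (l = Fin.natAdd 5 σ))) ^^ κ (bxor (bxor (bxor zeroVec (fun l => decide (l = Fin.castAdd 7 (3 : Fin 5)))) (fun l => decide (l = Fin.natAdd 5 σ))) (fun l => decide (l = Fin.natAdd 5 k)))))))) ^^ (v 3 && (((κ zeroVec ^^ κ (bxor zeroVec (fun l => decide (l = Fin.natAdd 5 k)))) ^^ (κ (bxor zeroVec (fun l => decide (l = Fin.natAdd 5 σ))) ^^ κ (bxor (bxor zeroVec (fun l => decide (l = Fin.natAdd 5 σ))) (fun l => decide (l = Fin.natAdd 5 k))))) ^^ ((κ (bxor zeroVec (fun l =>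 decide (l = Fin.castAdd 7 (4 : Fin 5)))) ^^ κ (bxor (bxor zeroVec (fun l => decide (l = Fin.castAdd 7 (4 : Fin 5)))) (fun l => decide (l = Fin.natAdd 5 k)))) ^^ (κ (bxor (bxor zeroVec (fun l => decide (l = Fin.castAdd 7 (4 : Fin 5)))) (fun l => decide (l = Fin.natAdd 5 σ))) ^^ κ (bxor (bxor (bxor zeroVec (fun l => decide (l = Fin.castAdd 7 (4 : Fin 5)))) (fun l => decide (l = Fin.natAdd 5 σ))) (fun l => decide (l = Fin.natAdd 5 k)))))))) := by
    intro σ k v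
    have h1 := tc5_second_cell κ (Matrix.vecCons false v) zeroVec σ k
    simp only [zeroVec_bxor] at h1
    have h2 := tc5_second_rho κ hκ (Matrix.vecCons false v) σ k
    dsimp only at h2
    have c0 : (Matrix.vecCons false v : Fin 5 → Bool) 0 = false := rfl; have c1 : (Matrix.vecCons false v : Fin 5 → Bool) 1 = v 0 := rfl
    have c2 : (Matrix.vecCons false v : Fin 5 → Bool) 2 = v 1 := rfl; have c3 : (Matrix.vecCons false v : Fin 5 → Bool) 3 = v 2 := rfl
    have c4 : (Matrix.vecCons false v : Fin 5 → Bool) 4 = v 3 := rfl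
    rw [c0, c1, c2, c3, c4, Bool.false_and, Bool.xor_false] at h2
    rw [h1]
    exact h2
  -- … and vanish on the exact cells (periodicity)
  have hAex : ∀ σ : Fin 7, 3 ≤ σ.val → ∀ (k : Fin 7) (v : Fin 4 → Bool), #(univ.filter fun s : Fin 7 → Bool => κ (Fin.append (Matrix.vecCons false v) s) = true) < 32 → ((κ (Fin.append (Matrix.vecCons false v) zeroVec) ^^ κ (Fin.append (Matrix.vecCons false v) (fun l => decide (l = k)))) ^^ (κ (Fin.append (Matrix.vecCons false v) (fun l => decide (l = σ))) ^^ κ (Fin.append (Matrix.vecCons false v) (bxor (fun l => decide (l = σ)) (fun l => decide (l = k)))))) = false := by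
    intro σ hσ k v hv
    have p1 := hper σ hσ v hv zeroVec
    rw [zeroVec_bxor] at p1
    have p2 := hper σ hσ v hv (fun l => decide (l = k))
    rw [bxor_comm (fun l => decide (l = σ)) (fun l => decide (l = k)), p2, p1]
    cases κ (Fin.append (Matrix.vecCons false v) zeroVec) <;> cases κ (Fin.append (Matrix.vecCons false v) (fun l => decide (l = k))) <;> rfl
  -- free vectors: the hypotheses of …CubicFormR4TCells for (scaled) unit vectors at free coordinates
  have hfree1 : ∀ (b : Bool) (n : Fin 7), 3 ≤ n.val →
      (fun l : Fin 7 => b && decide (l = n)) (Fin.castAdd 6 (0 : Fin 1)) = false ∧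
      (∀ i, (fun l : Fin 7 => b && decide (l = n)) (Fin.natAdd 1 (lo i)) = false) ∧
      (∀ i, (fun l : Fin 7 => b && decide (l = n)) (Fin.natAdd 1 (hi i)) = false) := by
    intro b n hn
    refine ⟨?_, fun i => ?_, fun i => ?_⟩
    · have : decide ((Fin.castAdd 6 (0 : Fin 1) : Fin (1 + 6)) = n) = false :=
        decide_eq_false (fun h => by have := congrArg Fin.val h; simp at this; omega)
      simp only [this, Bool.and_false]
    · have : decide ((Fin.natAdd 1 (lo i) : Fin (1 + 6)) = n) = false :=
        decide_eq_false (fun h => by have hv := congrArg Fin.val h; have e2 := hlov i; have h1 := i.isLt; simp only [Fin.val_natAdd] at hv; omega)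
      simp only [this, Bool.and_false]
    · have : decide ((Fin.natAdd 1 (hi i) : Fin (1 + 6)) = n) = false :=
        decide_eq_false (fun h => by have hv := congrArg Fin.val h; have e2 := hhiv i; have h1 := i.isLt; simp only [Fin.val_natAdd] at hv; omega)
      simp only [this, Bool.and_false]
  have hfreeE : ∀ n : Fin 7, 3 ≤ n.val →
      (fun l : Fin 7 => decide (l = n)) (Fin.castAdd 6 (0 : Fin 1)) = false ∧
      (∀ i, (fun l : Fin 7 => decide (l = n)) (Fin.natAdd 1 (lo i)) = false) ∧
      (∀ i, (fun l : Fin 7 => decide (l = n)) (Fin.natAdd 1 (hi i)) = false) := by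
    intro n hn
    obtain ⟨a1, a2, a3⟩ := hfree1 true n hn
    simp only [Bool.true_and] at a1 a2 a3
    exact ⟨a1, a2, a3⟩
  -- a flipping free derivative breaks the budget twice: from one `64`-cell `p` of `Z₁₀` with `f_p(U) = f_p(0)` to all of `Z₁₀`
  have hZ10 : ∀ U : Fin 7 → Bool, U (Fin.castAdd 6 (0 : Fin 1)) = false → (∀ i, U (Fin.natAdd 1 (lo i)) = false) →
      (∀ i, U (Fin.natAdd 1 (hi i)) = false) →
      (∀ (v : Fin 4 → Bool) (k : Fin 7), ((κ (Fin.append (Matrix.vecCons false v) zeroVec) ^^ κ (Fin.append (Matrix.vecCons false v) (fun l => decide (l = k)))) ^^ (κ (Fin.append (Matrix.vecCons false v) U) ^^ κ (Fin.append (Matrix.vecCons false v) (bxor U (fun l => decide (l = k)))))) = false) →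
      ∀ p : Fin 4 → Bool, ((p 0 && p 1) ^^ (p 2 && p 3)) = false → 64 ≤ #(univ.filter fun s : Fin 7 → Bool => κ (Fin.append (Matrix.vecCons false p) s) = true) → κ (Fin.append (Matrix.vecCons false p) U) = κ (Fin.append (Matrix.vecCons false p) zeroVec) →
      ∀ v : Fin 4 → Bool, ((v 0 && v 1) ^^ (v 2 && v 3)) = false → κ (Fin.append (Matrix.vecCons false v) U) = κ (Fin.append (Matrix.vecCons false v) zeroVec) := by
    intro U hU0 hUlo hUhi hΔ p hp h64p hpU v hv
    by_cases hvp : v = p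
    · subst hvp; exact hpU
    by_contra hne
    have hc := tq1_deriv_const (fun s : Fin (1 + 6) → Bool => κ (Fin.append (Matrix.vecCons false v) s)) 1 lo hi
      (fun a b : Fin 6 → Bool => decide ((∑ ii : Fin 1, ((if a (lo ii) = true then (1 : ZMod 2) else 0) * (if b (hi ii) = true then (1 : ZMod 2) else 0) + (if a (hi ii) = true then (1 : ZMod 2) else 0) * (if b (lo ii) = true then (1 : ZMod 2) else 0))) = 1)) (fun a b => rfl) (hshare (Matrix.vecCons false v)) U hU0 hUlo hUhi (fun m => hΔ v m)
    have hflip : ∀ s : Fin 7 → Bool, κ (Fin.append (Matrix.vecCons false v) (bxor s U)) = !κ (Fin.append (Matrix.vecCons false v) s) := by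
      intro s
      rw [hc s]
      revert hne
      cases κ (Fin.append (Matrix.vecCons false v) zeroVec) <;> cases κ (Fin.append (Matrix.vecCons false v) U) <;> cases κ (Fin.append (Matrix.vecCons false v) s) <;> decide
    have h64 := tq1_flip_card (fun s : Fin (1 + 6) → Bool => κ (Fin.append (Matrix.vecCons false v) s)) U hflip
    exact tq1_budget_two64 (fun v => #(univ.filter fun s : Fin 7 → Bool => κ (Fin.append (Matrix.vecCons false v) s) = true)) h16 hbudget p v hp hv (Ne.symm hvp) h64p (le_of_eq h64.symm)
  -- ===== CASE II.A: some `a_σk` with `σ, k` free is nonzero ⇒ those cells weigh `≥ 40` ⇒ budget `G40`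
  by_cases hFF : ∃ σ k : Fin 7, 3 ≤ σ.val ∧ 3 ≤ k.val ∧ ∃ v : Fin 4 → Bool, ((κ (Fin.append (Matrix.vecCons false v) zeroVec) ^^ κ (Fin.append (Matrix.vecCons false v) (fun l => decide (l = k)))) ^^ (κ (Fin.append (Matrix.vecCons false v) (fun l => decide (l = σ))) ^^ κ (Fin.append (Matrix.vecCons false v) (bxor (fun l => decide (l = σ)) (fun l => decide (l = k)))))) = true
  · obtain ⟨σ, k, hσ, hk3, v₁, hv₁⟩ := hFF
    obtain ⟨mσ, hσm, -, -, hml, hmh⟩ := hfreeσ σ hσ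
    obtain ⟨mk, hkm, -, -, hkl, hkh⟩ := hfreeσ k hk3
    have hA := tq1_affine_nonconst ((κ zeroVec ^^ κ (bxor zeroVec (fun l => decide (l = Fin.natAdd 5 k)))) ^^ (κ (bxor zeroVec (fun l => decide (l = Fin.natAdd 5 σ))) ^^ κ (bxor (bxor zeroVec (fun l => decide (l = Fin.natAdd 5 σ))) (fun l => decide (l = Fin.natAdd 5 k))))) (((κ zeroVec ^^ κ (bxor zeroVec (fun l => decide (l = Fin.natAdd 5 k)))) ^^ (κ (bxor zeroVec (fun l => decide (l = Fin.natAdd 5 σ))) ^^ κ (bxor (bxor zeroVec (fun l => decide (l = Fin.natAdd 5 σ))) (fun l => decide (l = Fin.natAdd 5 k))))) ^^ ((κ (bxor zeroVec (fun l => decide (l = Fin.castAdd 7 (1 : Fin 5)))) ^^ κ (bxor (bxor zeroVec (fun l => decide (l = Fin.castAdd 7 (1 : Fin 5)))) (fun l => decide (l = Fin.natAdd 5 k)))) ^^ (κ (bxor (bxor zeroVec (fun l => decide (l = Fin.castAdd 7 (1 : Fin 5)))) (fun l => decide (l = Fin.natAdd 5 σ))) ^^ κ (bxor (bxor (bxor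 zeroVec (fun l => decide (l = Fin.castAdd 7 (1 : Fin 5)))) (fun l => decide (l = Fin.natAdd 5 σ))) (fun l => decide (l = Fin.natAdd 5 k)))))) (((κ zeroVec ^^ κ (bxor zeroVec (fun l => decide (l = Fin.natAdd 5 k)))) ^^ (κ (bxor zeroVec (fun l => decide (l = Fin.natAdd 5 σ))) ^^ κ (bxor (bxor zeroVec (fun l => decide (l = Fin.natAdd 5 σ))) (fun l => decide (l = Fin.natAdd 5 k))))) ^^ ((κ (bxor zeroVec (fun l => decide (l = Fin.castAdd 7 (2 : Fin 5)))) ^^ κ (bxor (bxor zeroVec (fun l => decide (l = Fin.castAdd 7 (2 : Fin 5)))) (fun l => decide (l = Fin.natAdd 5 k)))) ^^ (κ (bxor (bxor zeroVec (fun l => decide (l = Fin.castAdd 7 (2 : Fin 5)))) (fun l => decide (l = Fin.natAdd 5 σ))) ^^ κ (bxor (bxor (bxor zeroVec (fun l => decide (l = Fin.castAdd 7 (2 : Fin 5)))) (fun l => decide (l = Fin.natAdd 5 σ))) (fun l => decide (l = Fin.natAdd 5 k)))))) (((κ zeroVec ^^ κ (bxor zeroVec (fun l => decide (l = Fin.natAdd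 5 k)))) ^^ (κ (bxor zeroVec (fun l => decide (l = Fin.natAdd 5 σ))) ^^ κ (bxor (bxor zeroVec (fun l => decide (l = Fin.natAdd 5 σ))) (fun l => decide (l = Fin.natAdd 5 k))))) ^^ ((κ (bxor zeroVec (fun l => decide (l = Fin.castAdd 7 (3 : Fin 5)))) ^^ κ (bxor (bxor zeroVec (fun l => decide (l = Fin.castAdd 7 (3 : Fin 5)))) (fun l => decide (l = Fin.natAdd 5 k)))) ^^ (κ (bxor (bxor zeroVec (fun l => decide (l = Fin.castAdd 7 (3 : Fin 5)))) (fun l => decide (l = Fin.natAdd 5 σ))) ^^ κ (bxor (bxor (bxor zeroVec (fun l => decide (l = Fin.castAdd 7 (3 : Fin 5)))) (fun l => decide (l = Fin.natAdd 5 σ))) (fun l => decide (l = Fin.natAdd 5 k)))))) (((κ zeroVec ^^ κ (bxor zeroVec (fun l => decide (l = Fin.natAdd 5 k)))) ^^ (κ (bxor zeroVec (fun l => decide (l = Fin.natAdd 5 σ))) ^^ κ (bxor (bxor zeroVec (fun l => decide (l = Fin.natAdd 5 σ))) (fun l => decide (l = Fin.natAdd 5 k))))) ^^ ((κ (bxor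 zeroVec (fun l => decide (l = Fin.castAdd 7 (4 : Fin 5)))) ^^ κ (bxor (bxor zeroVec (fun l => decide (l = Fin.castAdd 7 (4 : Fin 5)))) (fun l => decide (l = Fin.natAdd 5 k)))) ^^ (κ (bxor (bxor zeroVec (fun l => decide (l = Fin.castAdd 7 (4 : Fin 5)))) (fun l => decide (l = Fin.natAdd 5 σ))) ^^ κ (bxor (bxor (bxor zeroVec (fun l => decide (l = Fin.castAdd 7 (4 : Fin 5)))) (fun l => decide (l = Fin.natAdd 5 σ))) (fun l => decide (l = Fin.natAdd 5 k)))))) v₁ vc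
      (by rw [← haffine]; exact hv₁) (by rw [← haffine]; exact hAex σ hσ k vc hvc16)
    refine tq1_budget_g40 (fun v => #(univ.filter fun s : Fin 7 → Bool => κ (Fin.append (Matrix.vecCons false v) s) = true)) h16 hbudget ((κ zeroVec ^^ κ (bxor zeroVec (fun l => decide (l = Fin.natAdd 5 k)))) ^^ (κ (bxor zeroVec (fun l => decide (l = Fin.natAdd 5 σ))) ^^ κ (bxor (bxor zeroVec (fun l => decide (l = Fin.natAdd 5 σ))) (fun l => decide (l = Fin.natAdd 5 k))))) (((κ zeroVec ^^ κ (bxor zeroVec (fun l => decide (l = Fin.natAdd 5 k)))) ^^ (κ (bxor zeroVec (fun l => decide (l = Fin.natAdd 5 σ))) ^^ κ (bxor (bxor zeroVec (fun l => decide (l = Fin.natAdd 5 σ))) (fun l => decide (l = Fin.natAdd 5 k))))) ^^ ((κ (bxor zeroVec (fun l => decide (l = Fin.castAdd 7 (1 : Fin 5)))) ^^ κ (bxor (bxor zeroVec (fun l => decide (l = Fin.castAdd 7 (1 : Fin 5)))) (fun l => decide (l = Fin.natAdd 5 k)))) ^^ (κ (bxor (bxor zeroVec (fun l => decide (l = Fin.castAdd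 7 (1 : Fin 5)))) (fun l => decide (l = Fin.natAdd 5 σ))) ^^ κ (bxor (bxor (bxor zeroVec (fun l => decide (l = Fin.castAdd 7 (1 : Fin 5)))) (fun l => decide (l = Fin.natAdd 5 σ))) (fun l => decide (l = Fin.natAdd 5 k)))))) (((κ zeroVec ^^ κ (bxor zeroVec (fun l => decide (l = Fin.natAdd 5 k)))) ^^ (κ (bxor zeroVec (fun l => decide (l = Fin.natAdd 5 σ))) ^^ κ (bxor (bxor zeroVec (fun l => decide (l = Fin.natAdd 5 σ))) (fun l => decide (l = Fin.natAdd 5 k))))) ^^ ((κ (bxor zeroVec (fun l => decide (l = Fin.castAdd 7 (2 : Fin 5)))) ^^ κ (bxor (bxor zeroVec (fun l => decide (l = Fin.castAdd 7 (2 : Fin 5)))) (fun l => decide (l = Fin.natAdd 5 k)))) ^^ (κ (bxor (bxor zeroVec (fun l => decide (l = Fin.castAdd 7 (2 : Fin 5)))) (fun l => decide (l = Fin.natAdd 5 σ))) ^^ κ (bxor (bxor (bxor zeroVec (fun l => decide (l = Fin.castAdd 7 (2 : Fin 5)))) (fun l => decide (l = Fin.natAdd 5 σ))) (fun l => decide (l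 = Fin.natAdd 5 k)))))) (((κ zeroVec ^^ κ (bxor zeroVec (fun l => decide (l = Fin.natAdd 5 k)))) ^^ (κ (bxor zeroVec (fun l => decide (l = Fin.natAdd 5 σ))) ^^ κ (bxor (bxor zeroVec (fun l => decide (l = Fin.natAdd 5 σ))) (fun l => decide (l = Fin.natAdd 5 k))))) ^^ ((κ (bxor zeroVec (fun l => decide (l = Fin.castAdd 7 (3 : Fin 5)))) ^^ κ (bxor (bxor zeroVec (fun l => decide (l = Fin.castAdd 7 (3 : Fin 5)))) (fun l => decide (l = Fin.natAdd 5 k)))) ^^ (κ (bxor (bxor zeroVec (fun l => decide (l = Fin.castAdd 7 (3 : Fin 5)))) (fun l => decide (l = Fin.natAdd 5 σ))) ^^ κ (bxor (bxor (bxor zeroVec (fun l => decide (l = Fin.castAdd 7 (3 : Fin 5)))) (fun l => decide (l = Fin.natAdd 5 σ))) (fun l => decide (l = Fin.natAdd 5 k)))))) (((κ zeroVec ^^ κ (bxor zeroVec (fun l => decide (l = Fin.natAdd 5 k)))) ^^ (κ (bxor zeroVec (fun l => decide (l = Fin.natAdd 5 σ))) ^^ κ (bxor (bxor zeroVec (fun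 l => decide (l = Fin.natAdd 5 σ))) (fun l => decide (l = Fin.natAdd 5 k))))) ^^ ((κ (bxor zeroVec (fun l => decide (l = Fin.castAdd 7 (4 : Fin 5)))) ^^ κ (bxor (bxor zeroVec (fun l => decide (l = Fin.castAdd 7 (4 : Fin 5)))) (fun l => decide (l = Fin.natAdd 5 k)))) ^^ (κ (bxor (bxor zeroVec (fun l => decide (l = Fin.castAdd 7 (4 : Fin 5)))) (fun l => decide (l = Fin.natAdd 5 σ))) ^^ κ (bxor (bxor (bxor zeroVec (fun l => decide (l = Fin.castAdd 7 (4 : Fin 5)))) (fun l => decide (l = Fin.natAdd 5 σ))) (fun l => decide (l = Fin.natAdd 5 k)))))) hA (fun v hv hα => ?_)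
    rw [← haffine] at hα
    rw [← hσm, ← hkm] at hα
    exact tq1_cell_forty (fun s : Fin (1 + 6) → Bool => κ (Fin.append (Matrix.vecCons false v) s)) lo hi hlohi0
      (fun a b : Fin 6 → Bool => decide ((∑ ii : Fin 1, ((if a (lo ii) = true then (1 : ZMod 2) else 0) * (if b (hi ii) = true then (1 : ZMod 2) else 0) + (if a (hi ii) = true then (1 : ZMod 2) else 0) * (if b (lo ii) = true then (1 : ZMod 2) else 0))) = 1)) (fun a b => rfl) (hshare (Matrix.vecCons false v)) mσ mk hml hmh hkl hkh hα
  have hFF0 : ∀ σ k : Fin 7, 3 ≤ σ.val → 3 ≤ k.val → ∀ v : Fin 4 → Bool, ((κ (Fin.append (Matrix.vecCons false v) zeroVec) ^^ κ (Fin.append (Matrix.vecCons false v) (fun l => decide (l = k)))) ^^ (κ (Fin.append (Matrix.vecCons false v) (fun l => decide (l = σ))) ^^ κ (Fin.append (Matrix.vecCons false v) (bxor (fun l => decide (l = σ)) (fun l => decide (l = k)))))) = false := by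
    intro σ k hσ hk3 v
    by_contra hne
    exact hFF ⟨σ, k, hσ, hk3, v, by simpa using hne⟩
  -- ===== CASE II.B: some `a_σk` with `σ` free, `k ≤ 2` is nonzero (`=: α`)
  by_cases hVZ : ∃ σ k : Fin 7, 3 ≤ σ.val ∧ k.val < 3 ∧ ∃ v : Fin 4 → Bool, ((κ (Fin.append (Matrix.vecCons false v) zeroVec) ^^ κ (Fin.append (Matrix.vecCons false v) (fun l => decide (l = k)))) ^^ (κ (Fin.append (Matrix.vecCons false v) (fun l => decide (l = σ))) ^^ κ (Fin.append (Matrix.vecCons false v) (bxor (fun l => decide (l = σ)) (fun l => decide (l = k)))))) = true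
  · obtain ⟨σ₀, k₀, hσ₀, -, v₁, hv₁⟩ := hVZ
    have hA := tq1_affine_nonconst ((κ zeroVec ^^ κ (bxor zeroVec (fun l => decide (l = Fin.natAdd 5 k₀)))) ^^ (κ (bxor zeroVec (fun l => decide (l = Fin.natAdd 5 σ₀))) ^^ κ (bxor (bxor zeroVec (fun l => decide (l = Fin.natAdd 5 σ₀))) (fun l => decide (l = Fin.natAdd 5 k₀))))) (((κ zeroVec ^^ κ (bxor zeroVec (fun l => decide (l = Fin.natAdd 5 k₀)))) ^^ (κ (bxor zeroVec (fun l => decide (l = Fin.natAdd 5 σ₀))) ^^ κ (bxor (bxor zeroVec (fun l => decide (l = Fin.natAdd 5 σ₀))) (fun l => decide (l = Fin.natAdd 5 k₀))))) ^^ ((κ (bxor zeroVec (fun l => decide (l = Fin.castAdd 7 (1 : Fin 5)))) ^^ κ (bxor (bxor zeroVec (fun l => decide (l = Fin.castAdd 7 (1 : Fin 5)))) (fun l => decide (l = Fin.natAdd 5 k₀)))) ^^ (κ (bxor (bxor zeroVec (fun l => decide (l = Fin.castAdd 7 (1 : Fin 5)))) (fun l => decide (l = Fin.natAdd 5 σ₀)))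 ^^ κ (bxor (bxor (bxor zeroVec (fun l => decide (l = Fin.castAdd 7 (1 : Fin 5)))) (fun l => decide (l = Fin.natAdd 5 σ₀))) (fun l => decide (l = Fin.natAdd 5 k₀)))))) (((κ zeroVec ^^ κ (bxor zeroVec (fun l => decide (l = Fin.natAdd 5 k₀)))) ^^ (κ (bxor zeroVec (fun l => decide (l = Fin.natAdd 5 σ₀))) ^^ κ (bxor (bxor zeroVec (fun l => decide (l = Fin.natAdd 5 σ₀))) (fun l => decide (l = Fin.natAdd 5 k₀))))) ^^ ((κ (bxor zeroVec (fun l => decide (l = Fin.castAdd 7 (2 : Fin 5)))) ^^ κ (bxor (bxor zeroVec (fun l => decide (l = Fin.castAdd 7 (2 : Fin 5)))) (fun l => decide (l = Fin.natAdd 5 k₀)))) ^^ (κ (bxor (bxor zeroVec (fun l => decide (l = Fin.castAdd 7 (2 : Fin 5)))) (fun l => decide (l = Fin.natAdd 5 σ₀))) ^^ κ (bxor (bxor (bxor zeroVec (fun l => decide (l = Fin.castAdd 7 (2 : Fin 5)))) (fun l => decide (l = Fin.natAdd 5 σ₀))) (fun l => decide (l = Fin.natAdd 5 k₀)))))) (((κ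 zeroVec ^^ κ (bxor zeroVec (fun l => decide (l = Fin.natAdd 5 k₀)))) ^^ (κ (bxor zeroVec (fun l => decide (l = Fin.natAdd 5 σ₀))) ^^ κ (bxor (bxor zeroVec (fun l => decide (l = Fin.natAdd 5 σ₀))) (fun l => decide (l = Fin.natAdd 5 k₀))))) ^^ ((κ (bxor zeroVec (fun l => decide (l = Fin.castAdd 7 (3 : Fin 5)))) ^^ κ (bxor (bxor zeroVec (fun l => decide (l = Fin.castAdd 7 (3 : Fin 5)))) (fun l => decide (l = Fin.natAdd 5 k₀)))) ^^ (κ (bxor (bxor zeroVec (fun l => decide (l = Fin.castAdd 7 (3 : Fin 5)))) (fun l => decide (l = Fin.natAdd 5 σ₀))) ^^ κ (bxor (bxor (bxor zeroVec (fun l => decide (l = Fin.castAdd 7 (3 : Fin 5)))) (fun l => decide (l = Fin.natAdd 5 σ₀))) (fun l => decide (l = Fin.natAdd 5 k₀)))))) (((κ zeroVec ^^ κ (bxor zeroVec (fun l => decide (l = Fin.natAdd 5 k₀)))) ^^ (κ (bxor zeroVec (fun l => decide (l = Fin.natAdd 5 σ₀))) ^^ κ (bxor (bxor zeroVec (fun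 l => decide (l = Fin.natAdd 5 σ₀))) (fun l => decide (l = Fin.natAdd 5 k₀))))) ^^ ((κ (bxor zeroVec (fun l => decide (l = Fin.castAdd 7 (4 : Fin 5)))) ^^ κ (bxor (bxor zeroVec (fun l => decide (l = Fin.castAdd 7 (4 : Fin 5)))) (fun l => decide (l = Fin.natAdd 5 k₀)))) ^^ (κ (bxor (bxor zeroVec (fun l => decide (l = Fin.castAdd 7 (4 : Fin 5)))) (fun l => decide (l = Fin.natAdd 5 σ₀))) ^^ κ (bxor (bxor (bxor zeroVec (fun l => decide (l = Fin.castAdd 7 (4 : Fin 5)))) (fun l => decide (l = Fin.natAdd 5 σ₀))) (fun l => decide (l = Fin.natAdd 5 k₀)))))) v₁ vc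
      (by rw [← haffine]; exact hv₁) (by rw [← haffine]; exact hAex σ₀ hσ₀ k₀ vc hvc16)
    -- cells where `α = 1` are not exact
    have h32 : ∀ (σ k : Fin 7), 3 ≤ σ.val → ∀ v : Fin 4 → Bool, ((v 0 && v 1) ^^ (v 2 && v 3)) = false →
        ((((((κ zeroVec ^^ κ (bxor zeroVec (fun l => decide (l = Fin.natAdd 5 k)))) ^^ (κ (bxor zeroVec (fun l => decide (l = Fin.natAdd 5 σ))) ^^ κ (bxor (bxor zeroVec (fun l => decide (l = Fin.natAdd 5 σ))) (fun l => decide (l = Fin.natAdd 5 k))))) ^^ (v 0 && (((κ zeroVec ^^ κ (bxor zeroVec (fun l => decide (l = Fin.natAdd 5 k)))) ^^ (κ (bxor zeroVec (fun l => decide (l = Fin.natAdd 5 σ))) ^^ κ (bxor (bxor zeroVec (fun l => decide (l = Fin.natAdd 5 σ))) (fun l => decide (l = Fin.natAdd 5 k))))) ^^ ((κ (bxor zeroVec (fun l => decide (l = Fin.castAdd 7 (1 : Fin 5)))) ^^ κ (bxor (bxor zeroVec (fun l => decide (l = Fin.castAdd 7 (1 : Fin 5)))) (fun l => decide (l = Fin.natAdd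 5 k)))) ^^ (κ (bxor (bxor zeroVec (fun l => decide (l = Fin.castAdd 7 (1 : Fin 5)))) (fun l => decide (l = Fin.natAdd 5 σ))) ^^ κ (bxor (bxor (bxor zeroVec (fun l => decide (l = Fin.castAdd 7 (1 : Fin 5)))) (fun l => decide (l = Fin.natAdd 5 σ))) (fun l => decide (l = Fin.natAdd 5 k)))))))) ^^ (v 1 && (((κ zeroVec ^^ κ (bxor zeroVec (fun l => decide (l = Fin.natAdd 5 k)))) ^^ (κ (bxor zeroVec (fun l => decide (l = Fin.natAdd 5 σ))) ^^ κ (bxor (bxor zeroVec (fun l => decide (l = Fin.natAdd 5 σ))) (fun l => decide (l = Fin.natAdd 5 k))))) ^^ ((κ (bxor zeroVec (fun l => decide (l = Fin.castAdd 7 (2 : Fin 5)))) ^^ κ (bxor (bxor zeroVec (fun l => decide (l = Fin.castAdd 7 (2 : Fin 5)))) (fun l => decide (l = Fin.natAdd 5 k)))) ^^ (κ (bxor (bxor zeroVec (fun l => decide (l = Fin.castAdd 7 (2 : Fin 5)))) (fun l => decide (l = Fin.natAdd 5 σ))) ^^ κ (bxor (bxor (bxor zeroVec (fun l => decide (l =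 Fin.castAdd 7 (2 : Fin 5)))) (fun l => decide (l = Fin.natAdd 5 σ))) (fun l => decide (l = Fin.natAdd 5 k)))))))) ^^ (v 2 && (((κ zeroVec ^^ κ (bxor zeroVec (fun l => decide (l = Fin.natAdd 5 k)))) ^^ (κ (bxor zeroVec (fun l => decide (l = Fin.natAdd 5 σ))) ^^ κ (bxor (bxor zeroVec (fun l => decide (l = Fin.natAdd 5 σ))) (fun l => decide (l = Fin.natAdd 5 k))))) ^^ ((κ (bxor zeroVec (fun l => decide (l = Fin.castAdd 7 (3 : Fin 5)))) ^^ κ (bxor (bxor zeroVec (fun l => decide (l = Fin.castAdd 7 (3 : Fin 5)))) (fun l => decide (l = Fin.natAdd 5 k)))) ^^ (κ (bxor (bxor zeroVec (fun l => decide (l = Fin.castAdd 7 (3 : Fin 5)))) (fun l => decide (l = Fin.natAdd 5 σ))) ^^ κ (bxor (bxor (bxor zeroVec (fun l => decide (l = Fin.castAdd 7 (3 : Fin 5)))) (fun l => decide (l = Fin.natAdd 5 σ))) (fun l => decide (l = Fin.natAdd 5 k)))))))) ^^ (v 3 && (((κ zeroVec ^^ κ (bxor zeroVec (fun l => decide (l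 = Fin.natAdd 5 k)))) ^^ (κ (bxor zeroVec (fun l => decide (l = Fin.natAdd 5 σ))) ^^ κ (bxor (bxor zeroVec (fun l => decide (l = Fin.natAdd 5 σ))) (fun l => decide (l = Fin.natAdd 5 k))))) ^^ ((κ (bxor zeroVec (fun l => decide (l = Fin.castAdd 7 (4 : Fin 5)))) ^^ κ (bxor (bxor zeroVec (fun l => decide (l = Fin.castAdd 7 (4 : Fin 5)))) (fun l => decide (l = Fin.natAdd 5 k)))) ^^ (κ (bxor (bxor zeroVec (fun l => decide (l = Fin.castAdd 7 (4 : Fin 5)))) (fun l => decide (l = Fin.natAdd 5 σ))) ^^ κ (bxor (bxor (bxor zeroVec (fun l => decide (l = Fin.castAdd 7 (4 : Fin 5)))) (fun l => decide (l = Fin.natAdd 5 σ))) (fun l => decide (l = Fin.natAdd 5 k)))))))) = true →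
        32 ≤ #(univ.filter fun s : Fin 7 → Bool => κ (Fin.append (Matrix.vecCons false v) s) = true) := by
      intro σ k hσ v _ hα
      rw [← haffine] at hα
      by_contra hlt
      rw [not_le] at hlt
      rw [hAex σ hσ k v hlt] at hα
      exact Bool.false_ne_true hα
    -- proportionality `a_σk = Ξ_σk · α` for every free `σ`
    have hprop : ∀ σ k : Fin 7, 3 ≤ σ.val → ∃ x : Bool, ∀ v : Fin 4 → Bool, ((κ (Fin.append (Matrix.vecCons false v) zeroVec) ^^ κ (Fin.append (Matrix.vecCons false v) (fun l => decide (l = k)))) ^^ (κ (Fin.append (Matrix.vecCons false v) (fun l => decide (l = σ))) ^^ κ (Fin.append (Matrix.vecCons false v) (bxor (fun l => decide (l = σ)) (fun l => decide (l = k)))))) =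
        (x && ((((((κ zeroVec ^^ κ (bxor zeroVec (fun l => decide (l = Fin.natAdd 5 k₀)))) ^^ (κ (bxor zeroVec (fun l => decide (l = Fin.natAdd 5 σ₀))) ^^ κ (bxor (bxor zeroVec (fun l => decide (l = Fin.natAdd 5 σ₀))) (fun l => decide (l = Fin.natAdd 5 k₀))))) ^^ (v 0 && (((κ zeroVec ^^ κ (bxor zeroVec (fun l => decide (l = Fin.natAdd 5 k₀)))) ^^ (κ (bxor zeroVec (fun l => decide (l = Fin.natAdd 5 σ₀))) ^^ κ (bxor (bxor zeroVec (fun l => decide (l = Fin.natAdd 5 σ₀))) (fun l => decide (l = Fin.natAdd 5 k₀))))) ^^ ((κ (bxor zeroVec (fun l => decide (l = Fin.castAdd 7 (1 : Fin 5)))) ^^ κ (bxor (bxor zeroVec (fun l => decide (l = Fin.castAdd 7 (1 : Fin 5)))) (fun l => decide (l = Fin.natAdd 5 k₀)))) ^^ (κ (bxor (bxor zeroVec (fun l => decide (l = Fin.castAdd 7 (1 : Fin 5)))) (fun l => decide (l = Fin.natAdd 5 σ₀))) ^^ κ (bxor (bxor (bxor zeroVec (fun l => decide (l = Fin.castAdd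 7 (1 : Fin 5)))) (fun l => decide (l = Fin.natAdd 5 σ₀))) (fun l => decide (l = Fin.natAdd 5 k₀)))))))) ^^ (v 1 && (((κ zeroVec ^^ κ (bxor zeroVec (fun l => decide (l = Fin.natAdd 5 k₀)))) ^^ (κ (bxor zeroVec (fun l => decide (l = Fin.natAdd 5 σ₀))) ^^ κ (bxor (bxor zeroVec (fun l => decide (l = Fin.natAdd 5 σ₀))) (fun l => decide (l = Fin.natAdd 5 k₀))))) ^^ ((κ (bxor zeroVec (fun l => decide (l = Fin.castAdd 7 (2 : Fin 5)))) ^^ κ (bxor (bxor zeroVec (fun l => decide (l = Fin.castAdd 7 (2 : Fin 5)))) (fun l => decide (l = Fin.natAdd 5 k₀)))) ^^ (κ (bxor (bxor zeroVec (fun l => decide (l = Fin.castAdd 7 (2 : Fin 5)))) (fun l => decide (l = Fin.natAdd 5 σ₀))) ^^ κ (bxor (bxor (bxor zeroVec (fun l => decide (l = Fin.castAdd 7 (2 : Fin 5)))) (fun l => decide (l = Fin.natAdd 5 σ₀))) (fun l => decide (l = Fin.natAdd 5 k₀)))))))) ^^ (v 2 && (((κ zeroVec ^^ κ (bxor zeroVec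 (fun l => decide (l = Fin.natAdd 5 k₀)))) ^^ (κ (bxor zeroVec (fun l => decide (l = Fin.natAdd 5 σ₀))) ^^ κ (bxor (bxor zeroVec (fun l => decide (l = Fin.natAdd 5 σ₀))) (fun l => decide (l = Fin.natAdd 5 k₀))))) ^^ ((κ (bxor zeroVec (fun l => decide (l = Fin.castAdd 7 (3 : Fin 5)))) ^^ κ (bxor (bxor zeroVec (fun l => decide (l = Fin.castAdd 7 (3 : Fin 5)))) (fun l => decide (l = Fin.natAdd 5 k₀)))) ^^ (κ (bxor (bxor zeroVec (fun l => decide (l = Fin.castAdd 7 (3 : Fin 5)))) (fun l => decide (l = Fin.natAdd 5 σ₀))) ^^ κ (bxor (bxor (bxor zeroVec (fun l => decide (l = Fin.castAdd 7 (3 : Fin 5)))) (fun l => decide (l = Fin.natAdd 5 σ₀))) (fun l => decide (l = Fin.natAdd 5 k₀)))))))) ^^ (v 3 && (((κ zeroVec ^^ κ (bxor zeroVec (fun l => decide (l = Fin.natAdd 5 k₀)))) ^^ (κ (bxor zeroVec (fun l => decide (l = Fin.natAdd 5 σ₀))) ^^ κ (bxor (bxor zeroVec (fun l => decide (l = Fin.natAdd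 5 σ₀))) (fun l => decide (l = Fin.natAdd 5 k₀))))) ^^ ((κ (bxor zeroVec (fun l => decide (l = Fin.castAdd 7 (4 : Fin 5)))) ^^ κ (bxor (bxor zeroVec (fun l => decide (l = Fin.castAdd 7 (4 : Fin 5)))) (fun l => decide (l = Fin.natAdd 5 k₀)))) ^^ (κ (bxor (bxor zeroVec (fun l => decide (l = Fin.castAdd 7 (4 : Fin 5)))) (fun l => decide (l = Fin.natAdd 5 σ₀))) ^^ κ (bxor (bxor (bxor zeroVec (fun l => decide (l = Fin.castAdd 7 (4 : Fin 5)))) (fun l => decide (l = Fin.natAdd 5 σ₀))) (fun l => decide (l = Fin.natAdd 5 k₀))))))))) := by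
      intro σ k hσ
      obtain ⟨x, hx0, hx1, hx2, hx3, hx4⟩ := tq1_budget_g5 (fun v => #(univ.filter fun s : Fin 7 → Bool => κ (Fin.append (Matrix.vecCons false v) s) = true)) h16 hbudget ((κ zeroVec ^^ κ (bxor zeroVec (fun l => decide (l = Fin.natAdd 5 k₀)))) ^^ (κ (bxor zeroVec (fun l => decide (l = Fin.natAdd 5 σ₀))) ^^ κ (bxor (bxor zeroVec (fun l => decide (l = Fin.natAdd 5 σ₀))) (fun l => decide (l = Fin.natAdd 5 k₀))))) (((κ zeroVec ^^ κ (bxor zeroVec (fun l => decide (l = Fin.natAdd 5 k₀)))) ^^ (κ (bxor zeroVec (fun l => decide (l = Fin.natAdd 5 σ₀))) ^^ κ (bxor (bxor zeroVec (fun l => decide (l = Fin.natAdd 5 σ₀))) (fun l => decide (l = Fin.natAdd 5 k₀))))) ^^ ((κ (bxor zeroVec (fun l => decide (l = Fin.castAdd 7 (1 : Fin 5)))) ^^ κ (bxor (bxor zeroVec (fun l => decide (l = Fin.castAdd 7 (1 : Fin 5)))) (fun l => decide (l = Fin.natAdd 5 k₀)))) ^^ (κ (bxor (bxor zeroVec (fun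 l => decide (l = Fin.castAdd 7 (1 : Fin 5)))) (fun l => decide (l = Fin.natAdd 5 σ₀))) ^^ κ (bxor (bxor (bxor zeroVec (fun l => decide (l = Fin.castAdd 7 (1 : Fin 5)))) (fun l => decide (l = Fin.natAdd 5 σ₀))) (fun l => decide (l = Fin.natAdd 5 k₀)))))) (((κ zeroVec ^^ κ (bxor zeroVec (fun l => decide (l = Fin.natAdd 5 k₀)))) ^^ (κ (bxor zeroVec (fun l => decide (l = Fin.natAdd 5 σ₀))) ^^ κ (bxor (bxor zeroVec (fun l => decide (l = Fin.natAdd 5 σ₀))) (fun l => decide (l = Fin.natAdd 5 k₀))))) ^^ ((κ (bxor zeroVec (fun l => decide (l = Fin.castAdd 7 (2 : Fin 5)))) ^^ κ (bxor (bxor zeroVec (fun l => decide (l = Fin.castAdd 7 (2 : Fin 5)))) (fun l => decide (l = Fin.natAdd 5 k₀)))) ^^ (κ (bxor (bxor zeroVec (fun l => decide (l = Fin.castAdd 7 (2 : Fin 5)))) (fun l => decide (l = Fin.natAdd 5 σ₀))) ^^ κ (bxor (bxor (bxor zeroVec (fun l => decide (l = Fin.castAdd 7 (2 : Fin 5))))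 (fun l => decide (l = Fin.natAdd 5 σ₀))) (fun l => decide (l = Fin.natAdd 5 k₀)))))) (((κ zeroVec ^^ κ (bxor zeroVec (fun l => decide (l = Fin.natAdd 5 k₀)))) ^^ (κ (bxor zeroVec (fun l => decide (l = Fin.natAdd 5 σ₀))) ^^ κ (bxor (bxor zeroVec (fun l => decide (l = Fin.natAdd 5 σ₀))) (fun l => decide (l = Fin.natAdd 5 k₀))))) ^^ ((κ (bxor zeroVec (fun l => decide (l = Fin.castAdd 7 (3 : Fin 5)))) ^^ κ (bxor (bxor zeroVec (fun l => decide (l = Fin.castAdd 7 (3 : Fin 5)))) (fun l => decide (l = Fin.natAdd 5 k₀)))) ^^ (κ (bxor (bxor zeroVec (fun l => decide (l = Fin.castAdd 7 (3 : Fin 5)))) (fun l => decide (l = Fin.natAdd 5 σ₀))) ^^ κ (bxor (bxor (bxor zeroVec (fun l => decide (l = Fin.castAdd 7 (3 : Fin 5)))) (fun l => decide (l = Fin.natAdd 5 σ₀))) (fun l => decide (l = Fin.natAdd 5 k₀)))))) (((κ zeroVec ^^ κ (bxor zeroVec (fun l => decide (l = Fin.natAdd 5 k₀)))) ^^ (κ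 (bxor zeroVec (fun l => decide (l = Fin.natAdd 5 σ₀))) ^^ κ (bxor (bxor zeroVec (fun l => decide (l = Fin.natAdd 5 σ₀))) (fun l => decide (l = Fin.natAdd 5 k₀))))) ^^ ((κ (bxor zeroVec (fun l => decide (l = Fin.castAdd 7 (4 : Fin 5)))) ^^ κ (bxor (bxor zeroVec (fun l => decide (l = Fin.castAdd 7 (4 : Fin 5)))) (fun l => decide (l = Fin.natAdd 5 k₀)))) ^^ (κ (bxor (bxor zeroVec (fun l => decide (l = Fin.castAdd 7 (4 : Fin 5)))) (fun l => decide (l = Fin.natAdd 5 σ₀))) ^^ κ (bxor (bxor (bxor zeroVec (fun l => decide (l = Fin.castAdd 7 (4 : Fin 5)))) (fun l => decide (l = Fin.natAdd 5 σ₀))) (fun l => decide (l = Fin.natAdd 5 k₀)))))) hA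
        ((κ zeroVec ^^ κ (bxor zeroVec (fun l => decide (l = Fin.natAdd 5 k)))) ^^ (κ (bxor zeroVec (fun l => decide (l = Fin.natAdd 5 σ))) ^^ κ (bxor (bxor zeroVec (fun l => decide (l = Fin.natAdd 5 σ))) (fun l => decide (l = Fin.natAdd 5 k))))) (((κ zeroVec ^^ κ (bxor zeroVec (fun l => decide (l = Fin.natAdd 5 k)))) ^^ (κ (bxor zeroVec (fun l => decide (l = Fin.natAdd 5 σ))) ^^ κ (bxor (bxor zeroVec (fun l => decide (l = Fin.natAdd 5 σ))) (fun l => decide (l = Fin.natAdd 5 k))))) ^^ ((κ (bxor zeroVec (fun l => decide (l = Fin.castAdd 7 (1 : Fin 5)))) ^^ κ (bxor (bxor zeroVec (fun l => decide (l = Fin.castAdd 7 (1 : Fin 5)))) (fun l => decide (l = Fin.natAdd 5 k)))) ^^ (κ (bxor (bxor zeroVec (fun l => decide (l = Fin.castAdd 7 (1 : Fin 5)))) (fun l => decide (l = Fin.natAdd 5 σ))) ^^ κ (bxor (bxor (bxor zeroVec (fun l => decide (l = Fin.castAdd 7 (1 : Fin 5)))) (fun l => decide (l = Fin.natAdd 5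 σ))) (fun l => decide (l = Fin.natAdd 5 k)))))) (((κ zeroVec ^^ κ (bxor zeroVec (fun l => decide (l = Fin.natAdd 5 k)))) ^^ (κ (bxor zeroVec (fun l => decide (l = Fin.natAdd 5 σ))) ^^ κ (bxor (bxor zeroVec (fun l => decide (l = Fin.natAdd 5 σ))) (fun l => decide (l = Fin.natAdd 5 k))))) ^^ ((κ (bxor zeroVec (fun l => decide (l = Fin.castAdd 7 (2 : Fin 5)))) ^^ κ (bxor (bxor zeroVec (fun l => decide (l = Fin.castAdd 7 (2 : Fin 5)))) (fun l => decide (l = Fin.natAdd 5 k)))) ^^ (κ (bxor (bxor zeroVec (fun l => decide (l = Fin.castAdd 7 (2 : Fin 5)))) (fun l => decide (l = Fin.natAdd 5 σ))) ^^ κ (bxor (bxor (bxor zeroVec (fun l => decide (l = Fin.castAdd 7 (2 : Fin 5)))) (fun l => decide (l = Fin.natAdd 5 σ))) (fun l => decide (l = Fin.natAdd 5 k)))))) (((κ zeroVec ^^ κ (bxor zeroVec (fun l => decide (l = Fin.natAdd 5 k)))) ^^ (κ (bxor zeroVec (fun l => decide (l = Fin.natAdd 5 σ))) ^^ κ (bxor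 (bxor zeroVec (fun l => decide (l = Fin.natAdd 5 σ))) (fun l => decide (l = Fin.natAdd 5 k))))) ^^ ((κ (bxor zeroVec (fun l => decide (l = Fin.castAdd 7 (3 : Fin 5)))) ^^ κ (bxor (bxor zeroVec (fun l => decide (l = Fin.castAdd 7 (3 : Fin 5)))) (fun l => decide (l = Fin.natAdd 5 k)))) ^^ (κ (bxor (bxor zeroVec (fun l => decide (l = Fin.castAdd 7 (3 : Fin 5)))) (fun l => decide (l = Fin.natAdd 5 σ))) ^^ κ (bxor (bxor (bxor zeroVec (fun l => decide (l = Fin.castAdd 7 (3 : Fin 5)))) (fun l => decide (l = Fin.natAdd 5 σ))) (fun l => decide (l = Fin.natAdd 5 k)))))) (((κ zeroVec ^^ κ (bxor zeroVec (fun l => decide (l = Fin.natAdd 5 k)))) ^^ (κ (bxor zeroVec (fun l => decide (l = Fin.natAdd 5 σ))) ^^ κ (bxor (bxor zeroVec (fun l => decide (l = Fin.natAdd 5 σ))) (fun l => decide (l = Fin.natAdd 5 k))))) ^^ ((κ (bxor zeroVec (fun l => decide (l = Fin.castAdd 7 (4 : Fin 5)))) ^^ κ (bxor (bxor zeroVec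 (fun l => decide (l = Fin.castAdd 7 (4 : Fin 5)))) (fun l => decide (l = Fin.natAdd 5 k)))) ^^ (κ (bxor (bxor zeroVec (fun l => decide (l = Fin.castAdd 7 (4 : Fin 5)))) (fun l => decide (l = Fin.natAdd 5 σ))) ^^ κ (bxor (bxor (bxor zeroVec (fun l => decide (l = Fin.castAdd 7 (4 : Fin 5)))) (fun l => decide (l = Fin.natAdd 5 σ))) (fun l => decide (l = Fin.natAdd 5 k))))))
        (h32 σ₀ k₀ hσ₀) (h32 σ k hσ)
      refine ⟨x, fun v => ?_⟩
      rw [haffine σ k v, hx4, hx3, hx2, hx1, hx0]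
      exact tq1_af_smul x _ _ _ _ _ v
    obtain ⟨x30, hx30⟩ := hprop 3 0 (by decide); obtain ⟨x31, hx31⟩ := hprop 3 1 (by decide); obtain ⟨x32, hx32⟩ := hprop 3 2 (by decide)
    obtain ⟨x40, hx40⟩ := hprop 4 0 (by decide); obtain ⟨x41, hx41⟩ := hprop 4 1 (by decide); obtain ⟨x42, hx42⟩ := hprop 4 2 (by decide)
    obtain ⟨x50, hx50⟩ := hprop 5 0 (by decide); obtain ⟨x51, hx51⟩ := hprop 5 1 (by decide); obtain ⟨x52, hx52⟩ := hprop 5 2 (by decide)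
    obtain ⟨x60, hx60⟩ := hprop 6 0 (by decide); obtain ⟨x61, hx61⟩ := hprop 6 1 (by decide); obtain ⟨x62, hx62⟩ := hprop 6 2 (by decide)
    obtain ⟨u0, u1, u2, u3, hune, hc0, hc1, hc2⟩ := tq1_dep4 x30 x31 x32 x40 x41 x42 x50 x51 x52 x60 x61 x62
    -- the free vector `û = u0 e₃ ⊕ u1 e₄ ⊕ u2 e₅ ⊕ u3 e₆`
    obtain ⟨f30, f3l, f3h⟩ := hfree1 u0 3 (by decide); obtain ⟨f40, f4l, f4h⟩ := hfree1 u1 4 (by decide)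
    obtain ⟨f50, f5l, f5h⟩ := hfree1 u2 5 (by decide); obtain ⟨f60, f6l, f6h⟩ := hfree1 u3 6 (by decide)
    have hU0 : (bxor (bxor (bxor (fun l : Fin 7 => u0 && decide (l = (3 : Fin 7))) (fun l : Fin 7 => u1 && decide (l = (4 : Fin 7)))) (fun l : Fin 7 => u2 && decide (l = (5 : Fin 7)))) (fun l : Fin 7 => u3 && decide (l = (6 : Fin 7)))) (Fin.castAdd 6 (0 : Fin 1)) = false := by
      simp only [bxor, f30, f40, f50, f60, Bool.xor_false]
    have hUlo : ∀ i, (bxor (bxor (bxor (fun l : Fin 7 => u0 && decide (l = (3 : Fin 7))) (fun l : Fin 7 => u1 && decide (l = (4 : Fin 7)))) (fun l : Fin 7 => u2 && decide (l = (5 : Fin 7)))) (fun l : Fin 7 => u3 && decide (l = (6 : Fin 7)))) (Fin.natAdd 1 (lo i)) = false := by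
      intro i; simp only [bxor, f3l i, f4l i, f5l i, f6l i, Bool.xor_false]
    have hUhi : ∀ i, (bxor (bxor (bxor (fun l : Fin 7 => u0 && decide (l = (3 : Fin 7))) (fun l : Fin 7 => u1 && decide (l = (4 : Fin 7)))) (fun l : Fin 7 => u2 && decide (l = (5 : Fin 7)))) (fun l : Fin 7 => u3 && decide (l = (6 : Fin 7)))) (Fin.natAdd 1 (hi i)) = false := by
      intro i; simp only [bxor, f3h i, f4h i, f5h i, f6h i, Bool.xor_false]
    have hune' : (bxor (bxor (bxor (fun l : Fin 7 => u0 && decide (l = (3 : Fin 7))) (fun l : Fin 7 => u1 && decide (l = (4 : Fin 7)))) (fun l : Fin 7 => u2 && decide (l = (5 : Fin 7)))) (fun l : Fin 7 => u3 && decide (l = (6 : Fin 7)))) ≠ zeroVec := by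
      intro h0
      have e3 := congrFun h0 3; have e4 := congrFun h0 4; have e5 := congrFun h0 5; have e6 := congrFun h0 6
      simp only [bxor] at e3 e4 e5 e6
      revert hune e3 e4 e5 e6
      cases u0 <;> cases u1 <;> cases u2 <;> cases u3 <;> decide
    -- second differences along `(û, e_k)` vanish for every cell
    have h1 : ∀ (v : Fin 4 → Bool) (k : Fin 7),
        ((κ (Fin.append (Matrix.vecCons false v) zeroVec) ^^ κ (Fin.append (Matrix.vecCons false v) (fun l => decide (l = k)))) ^^ (κ (Fin.append (Matrix.vecCons false v) (bxor (bxor (bxor (fun l : Fin 7 => u0 && decide (l = (3 : Fin 7))) (fun l : Fin 7 => u1 && decide (l = (4 : Fin 7)))) (fun l : Fin 7 => u2 && decide (l = (5 : Fin 7)))) (fun l : Fin 7 => u3 && decide (l = (6 : Fin 7))))) ^^ κ (Fin.append (Matrix.vecCons false v) (bxor (bxor (bxor (bxor (fun l : Fin 7 => u0 && decide (l = (3 : Fin 7))) (fun l : Fin 7 => u1 && decide (l = (4 : Fin 7)))) (fun l : Fin 7 => u2 && decide (l = (5 : Fin 7)))) (fun l : Fin 7 => u3 && decide (l = (6 : Fin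 7)))) (fun l => decide (l = k)))))) = false := by
      intro v k
      have s3 := tq1_second_add (fun s : Fin (1 + 6) → Bool => κ (Fin.append (Matrix.vecCons false v) s)) 1 lo hi
        (fun a b : Fin 6 → Bool => decide ((∑ ii : Fin 1, ((if a (lo ii) = true then (1 : ZMod 2) else 0) * (if b (hi ii) = true then (1 : ZMod 2) else 0) + (if a (hi ii) = true then (1 : ZMod 2) else 0) * (if b (lo ii) = true then (1 : ZMod 2) else 0))) = 1)) (fun a b => rfl) (hshare (Matrix.vecCons false v)) (fun l : Fin 7 => u3 && decide (l = (6 : Fin 7))) f60 f6l f6h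
        (bxor (bxor (fun l : Fin 7 => u0 && decide (l = (3 : Fin 7))) (fun l : Fin 7 => u1 && decide (l = (4 : Fin 7)))) (fun l : Fin 7 => u2 && decide (l = (5 : Fin 7)))) (fun l => decide (l = k))
      have s2 := tq1_second_add (fun s : Fin (1 + 6) → Bool => κ (Fin.append (Matrix.vecCons false v) s)) 1 lo hi
        (fun a b : Fin 6 → Bool => decide ((∑ ii : Fin 1, ((if a (lo ii) = true then (1 : ZMod 2) else 0) * (if b (hi ii) = true then (1 : ZMod 2) else 0) + (if a (hi ii) = true then (1 : ZMod 2) else 0) * (if b (lo ii) = true then (1 : ZMod 2) else 0))) = 1)) (fun a b => rfl) (hshare (Matrix.vecCons false v)) (fun l : Fin 7 => u2 && decide (l = (5 : Fin 7))) f50 f5l f5h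
        (bxor (fun l : Fin 7 => u0 && decide (l = (3 : Fin 7))) (fun l : Fin 7 => u1 && decide (l = (4 : Fin 7)))) (fun l => decide (l = k))
      have s1 := tq1_second_add (fun s : Fin (1 + 6) → Bool => κ (Fin.append (Matrix.vecCons false v) s)) 1 lo hi
        (fun a b : Fin 6 → Bool => decide ((∑ ii : Fin 1, ((if a (lo ii) = true then (1 : ZMod 2) else 0) * (if b (hi ii) = true then (1 : ZMod 2) else 0) + (if a (hi ii) = true then (1 : ZMod 2) else 0) * (if b (lo ii) = true then (1 : ZMod 2) else 0))) = 1)) (fun a b => rfl) (hshare (Matrix.vecCons false v)) (fun l : Fin 7 => u1 && decide (l = (4 : Fin 7))) f40 f4l f4h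
        (fun l : Fin 7 => u0 && decide (l = (3 : Fin 7))) (fun l => decide (l = k))
      have m0 := tq1_second_smul (fun s : Fin (1 + 6) → Bool => κ (Fin.append (Matrix.vecCons false v) s)) u0 (fun l => decide (l = (3 : Fin 7))) (fun l => decide (l = k))
      have m1 := tq1_second_smul (fun s : Fin (1 + 6) → Bool => κ (Fin.append (Matrix.vecCons false v) s)) u1 (fun l => decide (l = (4 : Fin 7))) (fun l => decide (l = k))
      have m2 := tq1_second_smul (fun s : Fin (1 + 6) → Bool => κ (Fin.append (Matrix.vecCons false v) s)) u2 (fun l => decide (l = (5 : Fin 7))) (fun l => decide (l = k))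
      have m3 := tq1_second_smul (fun s : Fin (1 + 6) → Bool => κ (Fin.append (Matrix.vecCons false v) s)) u3 (fun l => decide (l = (6 : Fin 7))) (fun l => decide (l = k))
      rw [s3, s2, s1, m0, m1, m2, m3]
      by_cases hk3 : 3 ≤ k.val
      · rw [hFF0 3 k (by decide) hk3 v, hFF0 4 k (by decide) hk3 v, hFF0 5 k (by decide) hk3 v, hFF0 6 k (by decide) hk3 v]
        cases u0 <;> cases u1 <;> cases u2 <;> cases u3 <;> rfl
      · have hk' : k = 0 ∨ k = 1 ∨ k = 2 := by
          rcases k with ⟨kv, hkv⟩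
          have : kv = 0 ∨ kv = 1 ∨ kv = 2 := by simp at hk3; omega
          rcases this with h | h | h
          · left; exact Fin.ext h
          · right; left; exact Fin.ext h
          · right; right; exact Fin.ext h
        rcases hk' with rfl | rfl | rfl
        · rw [hx30, hx40, hx50, hx60, tq1_xor4_factor, hc0, Bool.false_and]
        · rw [hx31, hx41, hx51, hx61, tq1_xor4_factor, hc1, Bool.false_and]
        · rw [hx32, hx42, hx52, hx62, tq1_xor4_factor, hc2, Bool.false_and]
    -- no cell of `Z₁₀` flips along `û` (budget `G64`), so `f_v(û) = f_v(0)` on `Z₁₀`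
    have h2 : ∀ v : Fin 4 → Bool, ((v 0 && v 1) ^^ (v 2 && v 3)) = false →
        κ (Fin.append (Matrix.vecCons false v) (bxor (bxor (bxor (fun l : Fin 7 => u0 && decide (l = (3 : Fin 7))) (fun l : Fin 7 => u1 && decide (l = (4 : Fin 7)))) (fun l : Fin 7 => u2 && decide (l = (5 : Fin 7)))) (fun l : Fin 7 => u3 && decide (l = (6 : Fin 7))))) = κ (Fin.append (Matrix.vecCons false v) zeroVec) := by
      intro v hv
      by_contra hne
      have hc := tq1_deriv_const (fun s : Fin (1 + 6) → Bool => κ (Fin.append (Matrix.vecCons false v) s)) 1 lo hi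
        (fun a b : Fin 6 → Bool => decide ((∑ ii : Fin 1, ((if a (lo ii) = true then (1 : ZMod 2) else 0) * (if b (hi ii) = true then (1 : ZMod 2) else 0) + (if a (hi ii) = true then (1 : ZMod 2) else 0) * (if b (lo ii) = true then (1 : ZMod 2) else 0))) = 1)) (fun a b => rfl) (hshare (Matrix.vecCons false v)) _ hU0 hUlo hUhi (fun m => h1 v m)
      have hflip : ∀ s : Fin 7 → Bool,
          κ (Fin.append (Matrix.vecCons false v) (bxor s (bxor (bxor (bxor (fun l : Fin 7 => u0 && decide (l = (3 : Fin 7))) (fun l : Fin 7 => u1 && decide (l = (4 : Fin 7)))) (fun l : Fin 7 => u2 && decide (l = (5 : Fin 7)))) (fun l : Fin 7 => u3 && decide (l = (6 : Fin 7)))))) = !κ (Fin.append (Matrix.vecCons false v) s) := by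
        intro s
        rw [hc s]
        revert hne
        cases κ (Fin.append (Matrix.vecCons false v) zeroVec) <;> cases κ (Fin.append (Matrix.vecCons false v) (bxor (bxor (bxor (fun l : Fin 7 => u0 && decide (l = (3 : Fin 7))) (fun l : Fin 7 => u1 && decide (l = (4 : Fin 7)))) (fun l : Fin 7 => u2 && decide (l = (5 : Fin 7)))) (fun l : Fin 7 => u3 && decide (l = (6 : Fin 7))))) <;>
          cases κ (Fin.append (Matrix.vecCons false v) s) <;> decide
      have h64 := tq1_flip_card (fun s : Fin (1 + 6) → Bool => κ (Fin.append (Matrix.vecCons false v) s)) _ hflip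
      exact tq1_budget_g64 (fun v => #(univ.filter fun s : Fin 7 → Bool => κ (Fin.append (Matrix.vecCons false v) s) = true)) h16 hbudget ((κ zeroVec ^^ κ (bxor zeroVec (fun l => decide (l = Fin.natAdd 5 k₀)))) ^^ (κ (bxor zeroVec (fun l => decide (l = Fin.natAdd 5 σ₀))) ^^ κ (bxor (bxor zeroVec (fun l => decide (l = Fin.natAdd 5 σ₀))) (fun l => decide (l = Fin.natAdd 5 k₀))))) (((κ zeroVec ^^ κ (bxor zeroVec (fun l => decide (l = Fin.natAdd 5 k₀)))) ^^ (κ (bxor zeroVec (fun l => decide (l = Fin.natAdd 5 σ₀))) ^^ κ (bxor (bxor zeroVec (fun l => decide (l = Fin.natAdd 5 σ₀))) (fun l => decide (l = Fin.natAdd 5 k₀))))) ^^ ((κ (bxor zeroVec (fun l => decide (l = Fin.castAdd 7 (1 : Fin 5)))) ^^ κ (bxor (bxor zeroVec (fun l => decide (l = Fin.castAdd 7 (1 : Fin 5)))) (fun l => decide (l = Fin.natAdd 5 k₀)))) ^^ (κ (bxor (bxor zeroVec (fun l => decide (l = Fin.castAdd 7 (1 : Fin 5)))) (fun l => decide (l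 = Fin.natAdd 5 σ₀))) ^^ κ (bxor (bxor (bxor zeroVec (fun l => decide (l = Fin.castAdd 7 (1 : Fin 5)))) (fun l => decide (l = Fin.natAdd 5 σ₀))) (fun l => decide (l = Fin.natAdd 5 k₀)))))) (((κ zeroVec ^^ κ (bxor zeroVec (fun l => decide (l = Fin.natAdd 5 k₀)))) ^^ (κ (bxor zeroVec (fun l => decide (l = Fin.natAdd 5 σ₀))) ^^ κ (bxor (bxor zeroVec (fun l => decide (l = Fin.natAdd 5 σ₀))) (fun l => decide (l = Fin.natAdd 5 k₀))))) ^^ ((κ (bxor zeroVec (fun l => decide (l = Fin.castAdd 7 (2 : Fin 5)))) ^^ κ (bxor (bxor zeroVec (fun l => decide (l = Fin.castAdd 7 (2 : Fin 5)))) (fun l => decide (l = Fin.natAdd 5 k₀)))) ^^ (κ (bxor (bxor zeroVec (fun l => decide (l = Fin.castAdd 7 (2 : Fin 5)))) (fun l => decide (l = Fin.natAdd 5 σ₀))) ^^ κ (bxor (bxor (bxor zeroVec (fun l => decide (l = Fin.castAdd 7 (2 : Fin 5)))) (fun l => decide (l = Fin.natAdd 5 σ₀))) (fun l => decide (l = Fin.natAdd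 5 k₀)))))) (((κ zeroVec ^^ κ (bxor zeroVec (fun l => decide (l = Fin.natAdd 5 k₀)))) ^^ (κ (bxor zeroVec (fun l => decide (l = Fin.natAdd 5 σ₀))) ^^ κ (bxor (bxor zeroVec (fun l => decide (l = Fin.natAdd 5 σ₀))) (fun l => decide (l = Fin.natAdd 5 k₀))))) ^^ ((κ (bxor zeroVec (fun l => decide (l = Fin.castAdd 7 (3 : Fin 5)))) ^^ κ (bxor (bxor zeroVec (fun l => decide (l = Fin.castAdd 7 (3 : Fin 5)))) (fun l => decide (l = Fin.natAdd 5 k₀)))) ^^ (κ (bxor (bxor zeroVec (fun l => decide (l = Fin.castAdd 7 (3 : Fin 5)))) (fun l => decide (l = Fin.natAdd 5 σ₀))) ^^ κ (bxor (bxor (bxor zeroVec (fun l => decide (l = Fin.castAdd 7 (3 : Fin 5)))) (fun l => decide (l = Fin.natAdd 5 σ₀))) (fun l => decide (l = Fin.natAdd 5 k₀)))))) (((κ zeroVec ^^ κ (bxor zeroVec (fun l => decide (l = Fin.natAdd 5 k₀)))) ^^ (κ (bxor zeroVec (fun l => decide (l = Fin.natAdd 5 σ₀))) ^^ κ (bxor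 (bxor zeroVec (fun l => decide (l = Fin.natAdd 5 σ₀))) (fun l => decide (l = Fin.natAdd 5 k₀))))) ^^ ((κ (bxor zeroVec (fun l => decide (l = Fin.castAdd 7 (4 : Fin 5)))) ^^ κ (bxor (bxor zeroVec (fun l => decide (l = Fin.castAdd 7 (4 : Fin 5)))) (fun l => decide (l = Fin.natAdd 5 k₀)))) ^^ (κ (bxor (bxor zeroVec (fun l => decide (l = Fin.castAdd 7 (4 : Fin 5)))) (fun l => decide (l = Fin.natAdd 5 σ₀))) ^^ κ (bxor (bxor (bxor zeroVec (fun l => decide (l = Fin.castAdd 7 (4 : Fin 5)))) (fun l => decide (l = Fin.natAdd 5 σ₀))) (fun l => decide (l = Fin.natAdd 5 k₀)))))) hA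
        (h32 σ₀ k₀ hσ₀) v hv (le_of_eq h64.symm)
    exact tq1_radical_step κ hκ c d hdc hds hd hpair hF hzz _ (by simp [bxor]) (by simp [bxor]) (by simp [bxor]) hune' h1 h2
  -- ===== CASE I: all `a_σk` (σ free) vanish
  have hI : ∀ σ : Fin 7, 3 ≤ σ.val → ∀ (k : Fin 7) (v : Fin 4 → Bool), ((κ (Fin.append (Matrix.vecCons false v) zeroVec) ^^ κ (Fin.append (Matrix.vecCons false v) (fun l => decide (l = k)))) ^^ (κ (Fin.append (Matrix.vecCons false v) (fun l => decide (l = σ))) ^^ κ (Fin.append (Matrix.vecCons false v) (bxor (fun l => decide (l = σ)) (fun l => decide (l = k)))))) = false := by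
    intro σ hσ k v
    by_cases hk3 : 3 ≤ k.val
    · exact hFF0 σ k hσ hk3 v
    · by_contra hne
      exact hVZ ⟨σ, k, hσ, by omega, v, by simpa using hne⟩
  -- a `64`-cell `p` to dodge, if any
  by_cases h64 : ∃ p : Fin 4 → Bool, ((p 0 && p 1) ^^ (p 2 && p 3)) = false ∧ ∃ n : Fin 7, 3 ≤ n.val ∧ κ (Fin.append (Matrix.vecCons false p) (fun l => decide (l = n))) ≠ κ (Fin.append (Matrix.vecCons false p) zeroVec)
  · obtain ⟨p, hp, n, hn, hpn⟩ := h64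
    -- `p` weighs `64`
    obtain ⟨fn0, fnl, fnh⟩ := hfreeE n hn
    have hcn := tq1_deriv_const (fun s : Fin (1 + 6) → Bool => κ (Fin.append (Matrix.vecCons false p) s)) 1 lo hi
      (fun a b : Fin 6 → Bool => decide ((∑ ii : Fin 1, ((if a (lo ii) = true then (1 : ZMod 2) else 0) * (if b (hi ii) = true then (1 : ZMod 2) else 0) + (if a (hi ii) = true then (1 : ZMod 2) else 0) * (if b (lo ii) = true then (1 : ZMod 2) else 0))) = 1)) (fun a b => rfl) (hshare (Matrix.vecCons false p)) (fun l => decide (l = n)) fn0 fnl fnh (fun m => hI n hn m p)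
    have hflip : ∀ s : Fin 7 → Bool, κ (Fin.append (Matrix.vecCons false p) (bxor s (fun l => decide (l = n)))) = !κ (Fin.append (Matrix.vecCons false p) s) := by
      intro s
      rw [hcn s]
      revert hpn
      cases κ (Fin.append (Matrix.vecCons false p) zeroVec) <;> cases κ (Fin.append (Matrix.vecCons false p) (fun l => decide (l = n))) <;> cases κ (Fin.append (Matrix.vecCons false p) s) <;> decide
    have h64p : 64 ≤ #(univ.filter fun s : Fin 7 → Bool => κ (Fin.append (Matrix.vecCons false p) s) = true) := le_of_eq (tq1_flip_card (fun s : Fin (1 + 6) → Bool => κ (Fin.append (Matrix.vecCons false p) s)) _ hflip).symm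
    obtain ⟨g30, g3l, g3h⟩ := hfreeE 3 (by decide); obtain ⟨g40, g4l, g4h⟩ := hfreeE 4 (by decide)
    by_cases hc3 : κ (Fin.append (Matrix.vecCons false p) (fun l => decide (l = (3 : Fin 7)))) = κ (Fin.append (Matrix.vecCons false p) zeroVec)
    · -- `û = e₃`
      have h1 : ∀ (v : Fin 4 → Bool) (k : Fin 7), ((κ (Fin.append (Matrix.vecCons false v) zeroVec) ^^ κ (Fin.append (Matrix.vecCons false v) (fun l => decide (l = k)))) ^^ (κ (Fin.append (Matrix.vecCons false v) (fun l => decide (l = (3 : Fin 7)))) ^^ κ (Fin.append (Matrix.vecCons false v) (bxor (fun l => decide (l = (3 : Fin 7))) (fun l => decide (l = k)))))) = false := fun v k => hI 3 (by decide) k v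
      exact tq1_radical_step κ hκ c d hdc hds hd hpair hF hzz _ (by decide) (by decide) (by decide)
        (fun h0 => absurd (congrFun h0 3) (by simp [zeroVec]))
        h1 (hZ10 _ g30 g3l g3h h1 p hp h64p hc3)
    by_cases hc4 : κ (Fin.append (Matrix.vecCons false p) (fun l => decide (l = (4 : Fin 7)))) = κ (Fin.append (Matrix.vecCons false p) zeroVec)
    · -- `û = e₄`
      have h1 : ∀ (v : Fin 4 → Bool) (k : Fin 7), ((κ (Fin.append (Matrix.vecCons false v) zeroVec) ^^ κ (Fin.append (Matrix.vecCons false v) (fun l => decide (l = k)))) ^^ (κ (Fin.append (Matrix.vecCons false v) (fun l => decide (l = (4 : Fin 7)))) ^^ κ (Fin.append (Matrix.vecCons false v) (bxor (fun l => decide (l = (4 : Fin 7))) (fun l => decide (l = k)))))) = false := fun v k => hI 4 (by decide) k v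
      exact tq1_radical_step κ hκ c d hdc hds hd hpair hF hzz _ (by decide) (by decide) (by decide)
        (fun h0 => absurd (congrFun h0 4) (by simp [zeroVec]))
        h1 (hZ10 _ g40 g4l g4h h1 p hp h64p hc4)
    -- `û = e₃ ⊕ e₄`
    have hU0 : (bxor (fun l => decide (l = (3 : Fin 7))) (fun l => decide (l = (4 : Fin 7)))) (Fin.castAdd 6 (0 : Fin 1)) = false := by
      simp only [bxor, g30, g40, Bool.xor_false]
    have hUlo : ∀ i, (bxor (fun l => decide (l = (3 : Fin 7))) (fun l => decide (l = (4 : Fin 7)))) (Fin.natAdd 1 (lo i)) = false := by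
      intro i; simp only [bxor, g3l i, g4l i, Bool.xor_false]
    have hUhi : ∀ i, (bxor (fun l => decide (l = (3 : Fin 7))) (fun l => decide (l = (4 : Fin 7)))) (Fin.natAdd 1 (hi i)) = false := by
      intro i; simp only [bxor, g3h i, g4h i, Bool.xor_false]
    have h1 : ∀ (v : Fin 4 → Bool) (k : Fin 7), ((κ (Fin.append (Matrix.vecCons false v) zeroVec) ^^ κ (Fin.append (Matrix.vecCons false v) (fun l => decide (l = k)))) ^^ (κ (Fin.append (Matrix.vecCons false v) (bxor (fun l => decide (l = (3 : Fin 7))) (fun l => decide (l = (4 : Fin 7))))) ^^ κ (Fin.append (Matrix.vecCons false v) (bxor (bxor (fun l => decide (l = (3 : Fin 7))) (fun l => decide (l = (4 : Fin 7)))) (fun l => decide (l = k)))))) = false := by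
      intro v k
      have s1 := tq1_second_add (fun s : Fin (1 + 6) → Bool => κ (Fin.append (Matrix.vecCons false v) s)) 1 lo hi
        (fun a b : Fin 6 → Bool => decide ((∑ ii : Fin 1, ((if a (lo ii) = true then (1 : ZMod 2) else 0) * (if b (hi ii) = true then (1 : ZMod 2) else 0) + (if a (hi ii) = true then (1 : ZMod 2) else 0) * (if b (lo ii) = true then (1 : ZMod 2) else 0))) = 1)) (fun a b => rfl) (hshare (Matrix.vecCons false v)) (fun l => decide (l = (4 : Fin 7))) g40 g4l g4h (fun l => decide (l = (3 : Fin 7))) (fun l => decide (l = k))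
      rw [s1, hI 3 (by decide) k v, hI 4 (by decide) k v]
      rfl
    -- `f_p(e₃ ⊕ e₄) = f_p(0)` since both unit shifts flip `f_p`
    have hc4' := tq1_deriv_const (fun s : Fin (1 + 6) → Bool => κ (Fin.append (Matrix.vecCons false p) s)) 1 lo hi
      (fun a b : Fin 6 → Bool => decide ((∑ ii : Fin 1, ((if a (lo ii) = true then (1 : ZMod 2) else 0) * (if b (hi ii) = true then (1 : ZMod 2) else 0) + (if a (hi ii) = true then (1 : ZMod 2) else 0) * (if b (lo ii) = true then (1 : ZMod 2) else 0))) = 1)) (fun a b => rfl) (hshare (Matrix.vecCons false p)) (fun l => decide (l = (4 : Fin 7))) g40 g4l g4h (fun m => hI 4 (by decide) m p)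
    have hp34 : κ (Fin.append (Matrix.vecCons false p) (bxor (fun l => decide (l = (3 : Fin 7))) (fun l => decide (l = (4 : Fin 7))))) = κ (Fin.append (Matrix.vecCons false p) zeroVec) := by
      rw [hc4' (fun l => decide (l = (3 : Fin 7)))]
      revert hc3 hc4
      cases κ (Fin.append (Matrix.vecCons false p) zeroVec) <;> cases κ (Fin.append (Matrix.vecCons false p) (fun l => decide (l = (3 : Fin 7)))) <;> cases κ (Fin.append (Matrix.vecCons false p) (fun l => decide (l = (4 : Fin 7)))) <;> decide
    exact tq1_radical_step κ hκ c d hdc hds hd hpair hF hzz _ (by decide) (by decide) (by decide)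
      (fun h0 => absurd (congrFun h0 3) (by simp [bxor, zeroVec]))
      h1 (hZ10 _ hU0 hUlo hUhi h1 p hp h64p hp34)
  · -- no cell of `Z₁₀` flips along any free unit vector: `û = e₃`
    have h1 : ∀ (v : Fin 4 → Bool) (k : Fin 7), ((κ (Fin.append (Matrix.vecCons false v) zeroVec) ^^ κ (Fin.append (Matrix.vecCons false v) (fun l => decide (l = k)))) ^^ (κ (Fin.append (Matrix.vecCons false v) (fun l => decide (l = (3 : Fin 7)))) ^^ κ (Fin.append (Matrix.vecCons false v) (bxor (fun l => decide (l = (3 : Fin 7))) (fun l => decide (l = k)))))) = false := fun v k => hI 3 (by decide) k v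
    refine tq1_radical_step κ hκ c d hdc hds hd hpair hF hzz _ (by decide) (by decide) (by decide)
      (fun h0 => absurd (congrFun h0 3) (by simp [zeroVec])) h1 (fun v hv => ?_)
    by_contra hne
    exact h64 ⟨v, hv, 3, by decide, hne⟩

end Summit.QuantumAdvantage.QuantumAdvantage.Theorems.CubicForrelation.NearExactIsExact
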